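import Summits.CriticalPhenomena.PercolationContinuityZ3.Theorems.SahiMasterFamilyPointwiseCoordinateGluingSandwichApex

/-!
# One-coordinate gluing, VI (continued): the settled class is closed under "the `1`-minor is a zero flag" — order 3, general sandwich

Unit `prim-master-conj` (crux anchor stmt-CriticalPhenomena-4575, helper work), gen 18; memo
`run/shared/lean/prim/prim-l12/prim-master-conj/POINTWISE.md` §19.  Companion of `…CoordinateGluingSandwichApex` (the identity
`E_3(A,B,D) = (1−t)²E_3(A⁰,B⁰,C) + t(1−t)M + t(1−t)²ν_Aν_Bν_C` for a zero-flag `1`-minor and the nine-term certificate `M ≥ 0`).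
Here: `sandwichApex_M_eq_atoms` (the middle term as the explicit nine-term sum — pure algebra given the fourth sandwich moment relation) and
**`sahiE_three_settled_of_zVia`**: if the `1`-minor `(A¹,B¹,D¹)` of an increasing triple is a zero flag via `(A¹,B¹)` and the `0`-minor
`(A⁰,B⁰,D⁰)` is SETTLED on the open cube (`E_3 ≥ 0` and `E_3 = 0 → Z_3` at every interior parameter), then at every interior `p`
`E_3(μ_p; A,B,D) ≥ 0 ∧ (E_3(μ_p; A,B,D) = 0 ↔ (A,B,D) ∈ Z_3)` — i.e. `(A,B,D)` is settled at `p`.  This says: THE SETTLED CLASS AT ORDER 3 IS CLOSED UNDER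
EVERY ONE-COORDINATE EXTENSION WHOSE `1`-MINOR IS A ZERO FLAG — gen 15's (B), (C), (D), (F) are the special cases `K = univ`.  Proof: at `p`
every one of the eleven non-negative pieces of the identity vanishes; each piece is TRANSFERABLE (a Harris covariance of increasing events vanishes
iff the supports are disjoint, a cell has measure zero iff it is empty, `μ(K∖G) = 0` iff `K = G`, `ν_X = 0` iff `X¹ = X⁰`), so the identity at any
other parameter `q` gives `E_3(μ_q; A,B,D) = 0`, and (EQI-3) (`suppZeroFlag_of_eq_zero_on_paramBox`) concludes.  HONEST FRAMING: an inheritance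
theorem; Kahn's Conjecture 5 / `MasterFamilyEqIff 3` remain OPEN.  Axioms standard. [this work]
-/

noncomputable section

open scoped Classical

namespace Summit.CriticalPhenomena.PercolationContinuityZ3.Theorems

open Finset Function
open Literature.Combinatorics.Sahi2008
open Literature.Probability.Percolation (DeterminedBy)
open Literature.Probability.LatticeModels (prodBernoulli)
open Literature.Probability.LatticeModels.Kahn2022 (Affects real_inter_eq_mul_of_forall_not_affects)
open Literature.Probability.Percolation.DecisionTree (ind ind_of_mem ind_of_not_mem ind_nonneg)
open SahiCombDisjunct

namespace Pointwise

variable {ι : Type} [Fintype ι]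

/-! ### 6. The settled class is closed under "the `1`-minor is a zero flag" (order 3, general sandwich) -/

section Settled

variable (p : ι → unitInterval) (e : ι) (A B D K : Set (Set ι))

/-- The middle term `M` as the explicit nine-term sum (pure algebra given the fourth sandwich moment relation). [this work] -/
theorem sandwichApex_M_eq_atoms
    (h4 : ex (bernoulliWeight p) (ind (secAt e true A ∩ secAt e true B ∩ secAt e true D)) =
      ex (bernoulliWeight p) (ind K) * ex (bernoulliWeight p) (ind (secAt e true A)) * ex (bernoulliWeight p) (ind (secAt e true B))) :
    (2 * ex (bernoulliWeight p) (ind (secAt e false A ∩ secAt e false B ∩ secAt e false D))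
            - ex (bernoulliWeight p) (ind (secAt e true A)) * ex (bernoulliWeight p) (ind (secAt e false B ∩ secAt e false D))
            - ex (bernoulliWeight p) (ind (secAt e true B)) * ex (bernoulliWeight p) (ind (secAt e false A ∩ secAt e false D))
            - ex (bernoulliWeight p) (ind (secAt e true D)) * ex (bernoulliWeight p) (ind (secAt e false A ∩ secAt e false B))
            + ex (bernoulliWeight p) (ind (secAt e true A)) * ex (bernoulliWeight p) (ind (secAt e true B)) * ex (bernoulliWeight p) (ind (secAt e true D)))
          + (ex (bernoulliWeight p) (ind K) - ex (bernoulliWeight p) (ind (secAt e true D))) *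
            (ex (bernoulliWeight p) (ind (secAt e true A)) *
                (ex (bernoulliWeight p) (ind (secAt e true B)) - ex (bernoulliWeight p) (ind (secAt e false B)))
              + ex (bernoulliWeight p) (ind (secAt e true B)) *
                (ex (bernoulliWeight p) (ind (secAt e true A)) - ex (bernoulliWeight p) (ind (secAt e false A))))
      = (ex (bernoulliWeight p) (ind (secAt e false A ∩ secAt e false B ∩ secAt e true D))
            - ex (bernoulliWeight p) (ind K) * ex (bernoulliWeight p) (ind (secAt e false A ∩ secAt e false B)))
        + (ex (bernoulliWeight p) (ind (secAt e true A ∩ secAt e false B ∩ secAt e false D))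
            - ex (bernoulliWeight p) (ind (secAt e true A)) * ex (bernoulliWeight p) (ind (secAt e false B ∩ secAt e false D)))
        + (ex (bernoulliWeight p) (ind (secAt e false A ∩ secAt e true B ∩ secAt e false D))
            - ex (bernoulliWeight p) (ind (secAt e true B)) * ex (bernoulliWeight p) (ind (secAt e false A ∩ secAt e false D)))
        + (ex (bernoulliWeight p) (ind (secAt e false A ∩ secAt e true B ∩ secAt e true D))
            - ex (bernoulliWeight p) (ind (secAt e false A ∩ secAt e true B ∩ secAt e false D))
            - ex (bernoulliWeight p) (ind (secAt e false A ∩ secAt e false B ∩ secAt e true D))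
            + ex (bernoulliWeight p) (ind (secAt e false A ∩ secAt e false B ∩ secAt e false D)))
        + (ex (bernoulliWeight p) (ind (secAt e true A ∩ secAt e false B ∩ secAt e true D))
            - ex (bernoulliWeight p) (ind (secAt e true A ∩ secAt e false B ∩ secAt e false D))
            - ex (bernoulliWeight p) (ind (secAt e false A ∩ secAt e false B ∩ secAt e true D))
            + ex (bernoulliWeight p) (ind (secAt e false A ∩ secAt e false B ∩ secAt e false D)))
        + (ex (bernoulliWeight p) (ind (secAt e true A ∩ secAt e true B ∩ secAt e false D))
            - ex (bernoulliWeight p) (ind (secAt e true A ∩ secAt e false B ∩ secAt e false D))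
            - ex (bernoulliWeight p) (ind (secAt e false A ∩ secAt e true B ∩ secAt e false D))
            + ex (bernoulliWeight p) (ind (secAt e false A ∩ secAt e false B ∩ secAt e false D)))
        + (ex (bernoulliWeight p) (ind (secAt e true A ∩ secAt e true B ∩ secAt e true D))
            - ex (bernoulliWeight p) (ind (secAt e true A ∩ secAt e true B ∩ secAt e false D))
            - ex (bernoulliWeight p) (ind (secAt e true A ∩ secAt e false B ∩ secAt e true D))
            + ex (bernoulliWeight p) (ind (secAt e true A ∩ secAt e false B ∩ secAt e false D))
            - ex (bernoulliWeight p) (ind (secAt e false A ∩ secAt e true B ∩ secAt e true D))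
            + ex (bernoulliWeight p) (ind (secAt e false A ∩ secAt e true B ∩ secAt e false D))
            + ex (bernoulliWeight p) (ind (secAt e false A ∩ secAt e false B ∩ secAt e true D))
            - ex (bernoulliWeight p) (ind (secAt e false A ∩ secAt e false B ∩ secAt e false D)))
        + (ex (bernoulliWeight p) (ind K) - ex (bernoulliWeight p) (ind (secAt e true D))) *
          ((ex (bernoulliWeight p) (ind (secAt e false A ∩ secAt e false B))
              - ex (bernoulliWeight p) (ind (secAt e false A)) * ex (bernoulliWeight p) (ind (secAt e false B)))
            + (ex (bernoulliWeight p) (ind (secAt e true A)) - ex (bernoulliWeight p) (ind (secAt e false A))) *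
              (ex (bernoulliWeight p) (ind (secAt e true B)) - ex (bernoulliWeight p) (ind (secAt e false B)))) := by
  rw [h4]; ring

variable (hAu : IsUpperSet A) (hBu : IsUpperSet B) (hDu : IsUpperSet D)
  (hAne : (secAt e true A).Nonempty) (hBne : (secAt e true B).Nonempty)
  (hZ : ZVia (secAt e true A) (secAt e true B) (secAt e true D))
include hAu hBu hDu hAne hBne hZ

/-- **The settled class is closed under "the `1`-minor is a zero flag" (order 3, general sandwich)**: if `(A¹, B¹, D¹)` is a zero flag via
`(A¹, B¹)` and the `0`-minor `(A⁰, B⁰, D⁰)` is settled on the open cube (`E_3 ≥ 0` and `E_3 = 0 → Z_3` at every interior parameter), then at every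
interior `p`: `E_3(μ_p; A, B, D) ≥ 0` and `E_3(μ_p; A, B, D) = 0 ↔ (A, B, D) ∈ Z_3` (the positivity half is `sahiE_three_ge_sq_of_zVia`). [this work] -/
theorem sahiE_three_settled_of_zVia {p : ι → unitInterval} (hp : ∀ f, (p f : ℝ) ∈ Set.Ioo (0 : ℝ) 1)
    (hS : ∀ r : ι → unitInterval, (∀ f, (r f : ℝ) ∈ Set.Ioo (0 : ℝ) 1) →
      0 ≤ sahiE (bernoulliWeight r) 3 ![ind (secAt e false A), ind (secAt e false B), ind (secAt e false D)] ∧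
        (sahiE (bernoulliWeight r) 3 ![ind (secAt e false A), ind (secAt e false B), ind (secAt e false D)] = 0 →
          SuppZeroFlag 3 ![secAt e false A, secAt e false B, secAt e false D])) :
    0 ≤ sahiE (bernoulliWeight p) 3 (fun j => ind ((![A, B, D] : Fin 3 → Set (Set ι)) j)) ∧
      (sahiE (bernoulliWeight p) 3 (fun j => ind ((![A, B, D] : Fin 3 → Set (Set ι)) j)) = 0 ↔ SuppZeroFlag 3 ![A, B, D]) := by
  have hU : ∀ j, IsUpperSet ((![A, B, D] : Fin 3 → Set (Set ι)) j) := by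
    intro j; fin_cases j
    · exact hAu
    · exact hBu
    · exact hDu
  have hv : (fun j => ind ((![A, B, D] : Fin 3 → Set (Set ι)) j)) = ![ind A, ind B, ind D] := by
    funext j; fin_cases j <;> rfl
  have hv0 : (fun j => ind ((![secAt e false A, secAt e false B, secAt e false D] : Fin 3 → Set (Set ι)) j)) =
      ![ind (secAt e false A), ind (secAt e false B), ind (secAt e false D)] := by
    funext j; fin_cases j <;> rfl
  rw [hv]
  refine ⟨le_trans (mul_nonneg (pow_nonneg (sub_nonneg.2 (p e).2.2) 2) ((hS p hp).1))
    (sahiE_three_ge_sq_of_zVia p e A B D hAu hBu hDu hAne hBne hZ), fun hz => ?_, fun hZ3 => ?_⟩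
  swap
  · have := masterFamilyEqIff_mpr 3 ι p _ hZ3; rwa [hv] at this
  -- notation and structure
  set X := secAt e true A with hXdef
  set Y := secAt e true B with hYdef
  set G := secAt e true D with hGdef
  set A0 := secAt e false A with hA0def
  set B0 := secAt e false B with hB0def
  set C0 := secAt e false D with hC0def
  set K : Set (Set ι) := {ω : Set ι | ω ∪ ↑(esupp X ∪ esupp Y) ∈ G} with hK
  have hXu : IsUpperSet X := isUpperSet_secAt e true hAu
  have hYu : IsUpperSet Y := isUpperSet_secAt e true hBu
  have hGu : IsUpperSet G := isUpperSet_secAt e true hDu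
  have hA0u : IsUpperSet A0 := isUpperSet_secAt e false hAu
  have hB0u : IsUpperSet B0 := isUpperSet_secAt e false hBu
  have hC0u : IsUpperSet C0 := isUpperSet_secAt e false hDu
  have hKu : IsUpperSet K := isUpperSet_forcedHull hGu _
  have sA : A0 ⊆ X := RigidityAll.secAt_false_subset_secAt_true e hAu
  have sB : B0 ⊆ Y := RigidityAll.secAt_false_subset_secAt_true e hBu
  have sC : C0 ⊆ G := RigidityAll.secAt_false_subset_secAt_true e hDu
  have hXG : X ∩ G = X ∩ K := sandwich_left hXu hYu hGu hBne hZ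
  have hGK : G ⊆ K := subset_forcedHull hGu _
  have hKAB : K ∩ (A0 ∩ B0) = A0 ∩ B0 ∩ G := by
    ext ω
    simp only [Set.mem_inter_iff]
    constructor
    · rintro ⟨hKω, hA, hB⟩
      have : ω ∈ X ∩ G := by rw [hXG]; exact ⟨sA hA, hKω⟩
      exact ⟨⟨hA, hB⟩, this.2⟩
    · rintro ⟨⟨hA, hB⟩, hG⟩
      exact ⟨hGK hG, hA, hB⟩
  -- moment relations at any parameter
  have mom : ∀ r : ι → unitInterval,
      ex (bernoulliWeight r) (ind (X ∩ Y)) = ex (bernoulliWeight r) (ind X) * ex (bernoulliWeight r) (ind Y) ∧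
      ex (bernoulliWeight r) (ind (X ∩ G)) = ex (bernoulliWeight r) (ind K) * ex (bernoulliWeight r) (ind X) ∧
      ex (bernoulliWeight r) (ind (Y ∩ G)) = ex (bernoulliWeight r) (ind K) * ex (bernoulliWeight r) (ind Y) ∧
      ex (bernoulliWeight r) (ind (X ∩ Y ∩ G)) =
        ex (bernoulliWeight r) (ind K) * ex (bernoulliWeight r) (ind X) * ex (bernoulliWeight r) (ind Y) := fun r => by
    obtain ⟨m1, m2, m3, m4, -⟩ := sandwich_moments_of_zVia r hXu hYu hGu hAne hBne hZ
    exact ⟨m1, m2, m3, m4⟩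
  -- at `p`: every piece vanishes
  have ht0 : 0 < (p e : ℝ) := (hp e).1
  have ht1 : 0 < 1 - (p e : ℝ) := sub_pos.2 (hp e).2
  obtain ⟨h1, h2, h3, h4⟩ := mom p
  have hz' := hz
  rw [sahiE_three_sandwichApex_eq p e A B D _ h1 h2 h3 h4, sandwichApex_M_eq_atoms p e A B D K h4] at hz'
  have h0 := (hS p hp).1
  have t1 : 0 ≤ ex (bernoulliWeight p) (ind (A0 ∩ B0 ∩ G)) - ex (bernoulliWeight p) (ind K) * ex (bernoulliWeight p) (ind (A0 ∩ B0)) := by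
    rw [← hKAB]; exact cov_ind_nonneg p hKu (hA0u.inter hB0u)
  have t2 : 0 ≤ ex (bernoulliWeight p) (ind (X ∩ B0 ∩ C0)) - ex (bernoulliWeight p) (ind X) * ex (bernoulliWeight p) (ind (B0 ∩ C0)) := by
    rw [Set.inter_assoc]; exact cov_ind_nonneg p hXu (hB0u.inter hC0u)
  have t3 : 0 ≤ ex (bernoulliWeight p) (ind (A0 ∩ Y ∩ C0)) - ex (bernoulliWeight p) (ind Y) * ex (bernoulliWeight p) (ind (A0 ∩ C0)) := by
    rw [show A0 ∩ Y ∩ C0 = Y ∩ (A0 ∩ C0) by ac_rfl]; exact cov_ind_nonneg p hYu (hA0u.inter hC0u)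
  have t4 : 0 ≤ ex (bernoulliWeight p) (ind (A0 ∩ Y ∩ G)) - ex (bernoulliWeight p) (ind (A0 ∩ Y ∩ C0))
      - ex (bernoulliWeight p) (ind (A0 ∩ B0 ∩ G)) + ex (bernoulliWeight p) (ind (A0 ∩ B0 ∩ C0)) := by
    rw [← cell_inter_sdiff_sdiff _ A0 sB sC]; exact ex_ind_nonneg' p _
  have t5 : 0 ≤ ex (bernoulliWeight p) (ind (X ∩ B0 ∩ G)) - ex (bernoulliWeight p) (ind (X ∩ B0 ∩ C0))
      - ex (bernoulliWeight p) (ind (A0 ∩ B0 ∩ G)) + ex (bernoulliWeight p) (ind (A0 ∩ B0 ∩ C0)) := by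
    have := cell_inter_sdiff_sdiff (bernoulliWeight p) B0 sA sC
    rw [show B0 ∩ X ∩ G = X ∩ B0 ∩ G by ac_rfl, show B0 ∩ X ∩ C0 = X ∩ B0 ∩ C0 by ac_rfl, show B0 ∩ A0 ∩ G = A0 ∩ B0 ∩ G by ac_rfl,
      show B0 ∩ A0 ∩ C0 = A0 ∩ B0 ∩ C0 by ac_rfl] at this
    rw [← this]; exact ex_ind_nonneg' p _
  have t6 : 0 ≤ ex (bernoulliWeight p) (ind (X ∩ Y ∩ C0)) - ex (bernoulliWeight p) (ind (X ∩ B0 ∩ C0))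
      - ex (bernoulliWeight p) (ind (A0 ∩ Y ∩ C0)) + ex (bernoulliWeight p) (ind (A0 ∩ B0 ∩ C0)) := by
    have := cell_inter_sdiff_sdiff (bernoulliWeight p) C0 sA sB
    rw [show C0 ∩ X ∩ Y = X ∩ Y ∩ C0 by ac_rfl, show C0 ∩ X ∩ B0 = X ∩ B0 ∩ C0 by ac_rfl, show C0 ∩ A0 ∩ Y = A0 ∩ Y ∩ C0 by ac_rfl,
      show C0 ∩ A0 ∩ B0 = A0 ∩ B0 ∩ C0 by ac_rfl] at this
    rw [← this]; exact ex_ind_nonneg' p _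
  have t7 : 0 ≤ ex (bernoulliWeight p) (ind (X ∩ Y ∩ G)) - ex (bernoulliWeight p) (ind (X ∩ Y ∩ C0))
      - ex (bernoulliWeight p) (ind (X ∩ B0 ∩ G)) + ex (bernoulliWeight p) (ind (X ∩ B0 ∩ C0))
      - ex (bernoulliWeight p) (ind (A0 ∩ Y ∩ G)) + ex (bernoulliWeight p) (ind (A0 ∩ Y ∩ C0))
      + ex (bernoulliWeight p) (ind (A0 ∩ B0 ∩ G)) - ex (bernoulliWeight p) (ind (A0 ∩ B0 ∩ C0)) := by
    rw [← cell_sdiff_sdiff_sdiff _ sA sB sC]; exact ex_ind_nonneg' p _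
  have t8 : 0 ≤ ex (bernoulliWeight p) (ind K) - ex (bernoulliWeight p) (ind G) := by
    rw [ex_ind_sub_of_subset _ hGK]; exact ex_ind_nonneg' p _
  have nA := ex_secAt_true_sub_false_nonneg p e hAu
  have nB := ex_secAt_true_sub_false_nonneg p e hBu
  have nD := ex_secAt_true_sub_false_nonneg p e hDu
  have cAB := cov_ind_nonneg p hA0u hB0u
  have t9 : 0 ≤ (ex (bernoulliWeight p) (ind (A0 ∩ B0)) - ex (bernoulliWeight p) (ind A0) * ex (bernoulliWeight p) (ind B0))
      + (ex (bernoulliWeight p) (ind X) - ex (bernoulliWeight p) (ind A0)) * (ex (bernoulliWeight p) (ind Y) - ex (bernoulliWeight p) (ind B0)) :=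
    add_nonneg cAB (mul_nonneg nA nB)
  have t89 := mul_nonneg t8 t9
  have nnn := mul_nonneg (mul_nonneg nA nB) nD
  have w0 := mul_nonneg (pow_nonneg ht1.le 2) h0
  have wM := mul_nonneg (mul_nonneg ht0.le ht1.le)
    (add_nonneg (add_nonneg (add_nonneg (add_nonneg (add_nonneg (add_nonneg (add_nonneg t1 t2) t3) t4) t5) t6) t7) t89)
  have w2 := mul_nonneg (mul_nonneg ht0.le (pow_nonneg ht1.le 2)) nnn
  -- each of the three summands vanishes
  have s0 : (1 - (p e : ℝ)) ^ 2 * sahiE (bernoulliWeight p) 3 ![ind A0, ind B0, ind C0] = 0 := by linarith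
  have z0 : sahiE (bernoulliWeight p) 3 ![ind A0, ind B0, ind C0] = 0 := (mul_eq_zero.1 s0).resolve_left (pow_ne_zero 2 ht1.ne')
  have sM := le_antisymm (by linarith) wM
  have sM' := (mul_eq_zero.1 sM).resolve_left (mul_ne_zero ht0.ne' ht1.ne')
  have s2 : (p e : ℝ) * (1 - (p e : ℝ)) ^ 2 * ((ex (bernoulliWeight p) (ind X) - ex (bernoulliWeight p) (ind A0)) *
      (ex (bernoulliWeight p) (ind Y) - ex (bernoulliWeight p) (ind B0)) * (ex (bernoulliWeight p) (ind G) - ex (bernoulliWeight p) (ind C0))) = 0 := by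
    linarith
  have s2' := (mul_eq_zero.1 s2).resolve_left (mul_ne_zero ht0.ne' (pow_ne_zero 2 ht1.ne'))
  have z1 : ex (bernoulliWeight p) (ind (A0 ∩ B0 ∩ G)) - ex (bernoulliWeight p) (ind K) * ex (bernoulliWeight p) (ind (A0 ∩ B0)) = 0 := by linarith
  have z2 : ex (bernoulliWeight p) (ind (X ∩ B0 ∩ C0)) - ex (bernoulliWeight p) (ind X) * ex (bernoulliWeight p) (ind (B0 ∩ C0)) = 0 := by linarith
  have z3 : ex (bernoulliWeight p) (ind (A0 ∩ Y ∩ C0)) - ex (bernoulliWeight p) (ind Y) * ex (bernoulliWeight p) (ind (A0 ∩ C0)) = 0 := by linarith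
  have z4 : ex (bernoulliWeight p) (ind (A0 ∩ Y ∩ G)) - ex (bernoulliWeight p) (ind (A0 ∩ Y ∩ C0))
      - ex (bernoulliWeight p) (ind (A0 ∩ B0 ∩ G)) + ex (bernoulliWeight p) (ind (A0 ∩ B0 ∩ C0)) = 0 := by linarith
  have z5 : ex (bernoulliWeight p) (ind (X ∩ B0 ∩ G)) - ex (bernoulliWeight p) (ind (X ∩ B0 ∩ C0))
      - ex (bernoulliWeight p) (ind (A0 ∩ B0 ∩ G)) + ex (bernoulliWeight p) (ind (A0 ∩ B0 ∩ C0)) = 0 := by linarith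
  have z6 : ex (bernoulliWeight p) (ind (X ∩ Y ∩ C0)) - ex (bernoulliWeight p) (ind (X ∩ B0 ∩ C0))
      - ex (bernoulliWeight p) (ind (A0 ∩ Y ∩ C0)) + ex (bernoulliWeight p) (ind (A0 ∩ B0 ∩ C0)) = 0 := by linarith
  have z7 : ex (bernoulliWeight p) (ind (X ∩ Y ∩ G)) - ex (bernoulliWeight p) (ind (X ∩ Y ∩ C0))
      - ex (bernoulliWeight p) (ind (X ∩ B0 ∩ G)) + ex (bernoulliWeight p) (ind (X ∩ B0 ∩ C0))
      - ex (bernoulliWeight p) (ind (A0 ∩ Y ∩ G)) + ex (bernoulliWeight p) (ind (A0 ∩ Y ∩ C0))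
      + ex (bernoulliWeight p) (ind (A0 ∩ B0 ∩ G)) - ex (bernoulliWeight p) (ind (A0 ∩ B0 ∩ C0)) = 0 := by linarith
  have z89 : (ex (bernoulliWeight p) (ind K) - ex (bernoulliWeight p) (ind G)) *
      ((ex (bernoulliWeight p) (ind (A0 ∩ B0)) - ex (bernoulliWeight p) (ind A0) * ex (bernoulliWeight p) (ind B0))
        + (ex (bernoulliWeight p) (ind X) - ex (bernoulliWeight p) (ind A0)) * (ex (bernoulliWeight p) (ind Y) - ex (bernoulliWeight p) (ind B0))) = 0 := by
    linarith
  -- conclude via the parameter box: `E_3(q) = 0` for every interior `q`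
  refine suppZeroFlag_of_eq_zero_on_paramBox _ hU (a := fun _ => 0) (b := fun _ => 1) (fun _ => zero_lt_one) (fun _ => le_rfl)
    (fun _ => le_rfl) fun q hq => ?_
  rw [hv]
  obtain ⟨q1, q2, q3, q4⟩ := mom q
  have hZ0 : SuppZeroFlag 3 ![A0, B0, C0] := (hS p hp).2 z0
  have T0 : sahiE (bernoulliWeight q) 3 ![ind A0, ind B0, ind C0] = 0 := by
    have := masterFamilyEqIff_mpr 3 ι q _ hZ0; rwa [hv0] at this
  have T1 : ex (bernoulliWeight q) (ind (A0 ∩ B0 ∩ G)) - ex (bernoulliWeight q) (ind K) * ex (bernoulliWeight q) (ind (A0 ∩ B0)) = 0 := by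
    rw [← hKAB] at z1 ⊢; exact cov_ind_eq_zero_transfer hp q hKu (hA0u.inter hB0u) z1
  have T2 : ex (bernoulliWeight q) (ind (X ∩ B0 ∩ C0)) - ex (bernoulliWeight q) (ind X) * ex (bernoulliWeight q) (ind (B0 ∩ C0)) = 0 := by
    rw [Set.inter_assoc] at z2 ⊢; exact cov_ind_eq_zero_transfer hp q hXu (hB0u.inter hC0u) z2
  have T3 : ex (bernoulliWeight q) (ind (A0 ∩ Y ∩ C0)) - ex (bernoulliWeight q) (ind Y) * ex (bernoulliWeight q) (ind (A0 ∩ C0)) = 0 := by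
    rw [show A0 ∩ Y ∩ C0 = Y ∩ (A0 ∩ C0) by ac_rfl] at z3 ⊢; exact cov_ind_eq_zero_transfer hp q hYu (hA0u.inter hC0u) z3
  have T4 : ex (bernoulliWeight q) (ind (A0 ∩ Y ∩ G)) - ex (bernoulliWeight q) (ind (A0 ∩ Y ∩ C0))
      - ex (bernoulliWeight q) (ind (A0 ∩ B0 ∩ G)) + ex (bernoulliWeight q) (ind (A0 ∩ B0 ∩ C0)) = 0 := by
    rw [← cell_inter_sdiff_sdiff _ A0 sB sC] at z4 ⊢; exact ex_ind_eq_zero_transfer hp q _ z4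
  have T5 : ex (bernoulliWeight q) (ind (X ∩ B0 ∩ G)) - ex (bernoulliWeight q) (ind (X ∩ B0 ∩ C0))
      - ex (bernoulliWeight q) (ind (A0 ∩ B0 ∩ G)) + ex (bernoulliWeight q) (ind (A0 ∩ B0 ∩ C0)) = 0 := by
    have hc := fun r : ι → unitInterval => cell_inter_sdiff_sdiff (bernoulliWeight r) B0 sA sC
    simp only [show B0 ∩ X ∩ G = X ∩ B0 ∩ G by ac_rfl, show B0 ∩ X ∩ C0 = X ∩ B0 ∩ C0 by ac_rfl, show B0 ∩ A0 ∩ G = A0 ∩ B0 ∩ G by ac_rfl,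
      show B0 ∩ A0 ∩ C0 = A0 ∩ B0 ∩ C0 by ac_rfl] at hc
    rw [← hc p] at z5; rw [← hc q]; exact ex_ind_eq_zero_transfer hp q _ z5
  have T6 : ex (bernoulliWeight q) (ind (X ∩ Y ∩ C0)) - ex (bernoulliWeight q) (ind (X ∩ B0 ∩ C0))
      - ex (bernoulliWeight q) (ind (A0 ∩ Y ∩ C0)) + ex (bernoulliWeight q) (ind (A0 ∩ B0 ∩ C0)) = 0 := by
    have hc := fun r : ι → unitInterval => cell_inter_sdiff_sdiff (bernoulliWeight r) C0 sA sB
    simp only [show C0 ∩ X ∩ Y = X ∩ Y ∩ C0 by ac_rfl, show C0 ∩ X ∩ B0 = X ∩ B0 ∩ C0 by ac_rfl, show C0 ∩ A0 ∩ Y = A0 ∩ Y ∩ C0 by ac_rfl,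
      show C0 ∩ A0 ∩ B0 = A0 ∩ B0 ∩ C0 by ac_rfl] at hc
    rw [← hc p] at z6; rw [← hc q]; exact ex_ind_eq_zero_transfer hp q _ z6
  have T7 : ex (bernoulliWeight q) (ind (X ∩ Y ∩ G)) - ex (bernoulliWeight q) (ind (X ∩ Y ∩ C0))
      - ex (bernoulliWeight q) (ind (X ∩ B0 ∩ G)) + ex (bernoulliWeight q) (ind (X ∩ B0 ∩ C0))
      - ex (bernoulliWeight q) (ind (A0 ∩ Y ∩ G)) + ex (bernoulliWeight q) (ind (A0 ∩ Y ∩ C0))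
      + ex (bernoulliWeight q) (ind (A0 ∩ B0 ∩ G)) - ex (bernoulliWeight q) (ind (A0 ∩ B0 ∩ C0)) = 0 := by
    rw [← cell_sdiff_sdiff_sdiff _ sA sB sC] at z7 ⊢; exact ex_ind_eq_zero_transfer hp q _ z7
  have T89 : (ex (bernoulliWeight q) (ind K) - ex (bernoulliWeight q) (ind G)) *
      ((ex (bernoulliWeight q) (ind (A0 ∩ B0)) - ex (bernoulliWeight q) (ind A0) * ex (bernoulliWeight q) (ind B0))
        + (ex (bernoulliWeight q) (ind X) - ex (bernoulliWeight q) (ind A0)) * (ex (bernoulliWeight q) (ind Y) - ex (bernoulliWeight q) (ind B0))) = 0 := by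
    rcases mul_eq_zero.1 z89 with h | h
    · rw [ex_ind_sub_of_subset _ hGK] at h
      rw [ex_ind_sub_of_subset _ hGK, ex_ind_eq_zero_transfer hp q _ h, zero_mul]
    · have hcv : ex (bernoulliWeight p) (ind (A0 ∩ B0)) - ex (bernoulliWeight p) (ind A0) * ex (bernoulliWeight p) (ind B0) = 0 := by
        linarith [cAB, mul_nonneg nA nB]
      have hnn : (ex (bernoulliWeight p) (ind X) - ex (bernoulliWeight p) (ind A0)) *
          (ex (bernoulliWeight p) (ind Y) - ex (bernoulliWeight p) (ind B0)) = 0 := by linarith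
      have Tn : (ex (bernoulliWeight q) (ind X) - ex (bernoulliWeight q) (ind A0)) *
          (ex (bernoulliWeight q) (ind Y) - ex (bernoulliWeight q) (ind B0)) = 0 := by
        rcases mul_eq_zero.1 hnn with h' | h'
        · rw [ex_secAt_sub_eq_zero_transfer hp q e hAu h', zero_mul]
        · rw [ex_secAt_sub_eq_zero_transfer hp q e hBu h', mul_zero]
      rw [Tn, cov_ind_eq_zero_transfer hp q hA0u hB0u hcv, add_zero, mul_zero]
  have Tnnn : (ex (bernoulliWeight q) (ind X) - ex (bernoulliWeight q) (ind A0)) *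
      (ex (bernoulliWeight q) (ind Y) - ex (bernoulliWeight q) (ind B0)) * (ex (bernoulliWeight q) (ind G) - ex (bernoulliWeight q) (ind C0)) = 0 := by
    rcases mul_eq_zero.1 s2' with h | h
    · rcases mul_eq_zero.1 h with h' | h'
      · rw [ex_secAt_sub_eq_zero_transfer hp q e hAu h', zero_mul, zero_mul]
      · rw [ex_secAt_sub_eq_zero_transfer hp q e hBu h', mul_zero, zero_mul]
    · rw [ex_secAt_sub_eq_zero_transfer hp q e hDu h, mul_zero]
  rw [sahiE_three_sandwichApex_eq q e A B D _ q1 q2 q3 q4, sandwichApex_M_eq_atoms q e A B D K q4, T0, T1, T2, T3, T4, T5, T6, T7, T89]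
  have : (q e : ℝ) * (1 - (q e : ℝ)) ^ 2 * ((ex (bernoulliWeight q) (ind X) - ex (bernoulliWeight q) (ind A0)) *
      (ex (bernoulliWeight q) (ind Y) - ex (bernoulliWeight q) (ind B0)) * (ex (bernoulliWeight q) (ind G) - ex (bernoulliWeight q) (ind C0))) = 0 := by
    rw [Tnnn, mul_zero]
  linarith

end Settled

end Pointwise

end Summit.CriticalPhenomena.PercolationContinuityZ3.Theorems

end
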